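import Mathlib
import Literature.Analysis.FluidPDE.GalerkinFlow
import Literature.Analysis.FunctionSpaces.TorusTrigPoly

/-!
# Stub `stub_finiteHorizon` of line `Sketch` — crux `WazewskiBlock.UniformWorkFloorTrap`
# (stmt-AnomalousDissipation-10353)

Sorry-free discharge of the registered stub `stub_finiteHorizon` of the lead's skeleton
(`Cruxes/UniformWorkFloorTrap/Lines/Sketch.lean`): the **finite-horizon principle** for the
Galerkin semiflow `Torus.galerkinFlow ν f N` of order `N` on the block
`B = {kineticEnergy ≤ E} ∩ {(f, ·) ≥ ε₀}` of Galerkin modes of order `N` — if for every horizon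
`n : ℕ` some orbit stays in `B` on `[0, n]`, then some orbit stays in `B` for all `t ≥ 0` (the
crux at `(ν, N)` `⟺` arbitrarily long loud bounded sojourns `⟺` `sup` exit time `= ∞`).

**Proof.** Pure topology in the finite-dimensional phase space
`X = ↥(galerkinSubspace (freqBall N))` of real divergence-free coefficient vectors, with the
semiflow `Φ = galerkinPhaseFlow ν (f̂|_{≤N})` (`galerkinPhaseFlow_semiflow`: joint continuity on
`[0, ∞) × X`, `Φ 0 = id`).
* Dictionary (`kineticEnergy_phase`, `work_phase`): on `X` the energy of the field
  `realTrigPoly (freqBall N) c̄` is `½ ∑ₖ ‖c k‖²` (`kineticEnergy_realTrigPoly`) and its work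
  against `f ∈ L²` is the finite sum `∑ₖ Re ⟪f̂ k, c k⟫` (`integral_inner_realTrigPoly_right`);
  both are continuous on `X`, so the coefficient block
  `Bc = {½∑‖c k‖² ≤ E} ∩ {ε₀ ≤ ∑ Re ⟪f̂ k, c k⟫}` is closed, and it is bounded
  (`‖c‖² ≤ ∑ ‖c k‖² ≤ 2E`), hence compact (`X` is proper).
* Cantor (`finiteHorizon_of_compact`): the survivor sets `K n = ⋂_{t ∈ [0,n]} (Φ t)⁻¹' Bc` are
  closed (each `Φ t`, `t ≥ 0`, is continuous), contained in `Bc` (`Φ 0 = id`), nested and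
  nonempty, so `⋂ₙ K n ≠ ∅` (`IsCompact.nonempty_iInter_of_directed_nonempty_isCompact_isClosed`).
* Conjugacy: the hypothesis' Galerkin mode `a` is transported to `⟨â|_{≤N}, _⟩ ∈ X`
  (`IsGalerkinMode.fourierRestrict_mem`, `IsGalerkinMode.galerkinFlow_eq`), and the survivor `c⋆`
  back to the Galerkin mode `realTrigPoly (freqBall N) c̄⋆` (`isGalerkinMode_realTrigPoly_coeffExt`,
  `Torus.galerkinFlow_realTrigPoly`).

References: J. K. Hale, L. T. Magalhães, W. M. Oliva, *Dynamics in Infinite Dimensions*, 2nd ed.,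
Springer 2002, App. A (semiflows); C. Conley, *Isolated Invariant Sets and the Morse Index*,
CBMS 38 (1978), §II (compactness of `Inv⁺`); J. C. Robinson, J. L. Rodrigo, W. Sadowski, *The
three-dimensional Navier–Stokes equations*, CUP 2016, §4.1 (the Galerkin system).
-/

-- `Summit.<Summit>.<Problem>` is the tree's mandated summit-side namespace (CONVENTIONS §2); for
-- this single-conjunct summit the two coincide, so the duplicate is deliberate.
set_option linter.dupNamespace false

noncomputable section

namespace Summit.AnomalousDissipation.AnomalousDissipation.Theorems.UniformWorkFloorTrap.Sketch

open scoped InnerProductSpace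
open MeasureTheory Filter Set UnitAddTorus
open Literature.Analysis.FunctionSpaces Literature.Analysis.FunctionSpaces.Torus
open Literature.Analysis.FluidPDE

/-! ## The abstract finite-horizon principle (Cantor intersection) -/

/-- **Finite-horizon principle for time-`t`-continuous dynamics on a compact closed block.** If
every `φ t`, `t ≥ 0`, is continuous, `φ 0 = id`, `B` is compact and closed, and for every horizon
`n : ℕ` some point has `φ t x ∈ B` for all `t ∈ [0, n]`, then some point has `φ t x ∈ B` for all
`t ≥ 0`: the survivor sets `⋂_{t ∈ [0, n]} (φ t)⁻¹' B` are closed, contained in `B`, nested and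
nonempty, so their intersection is nonempty (Cantor). [folklore] -/
theorem finiteHorizon_of_compact {X : Type*} [TopologicalSpace X] {φ : ℝ → X → X}
    (hφ : ∀ t : ℝ, 0 ≤ t → Continuous (φ t)) (h0 : ∀ x, φ 0 x = x) {B : Set X}
    (hBc : IsCompact B) (hBcl : IsClosed B)
    (h : ∀ n : ℕ, ∃ x, ∀ t ∈ Set.Icc (0 : ℝ) n, φ t x ∈ B) :
    ∃ x, ∀ t : ℝ, 0 ≤ t → φ t x ∈ B := by
  let K : ℕ → Set X := fun n => ⋂ t ∈ Set.Icc (0 : ℝ) n, φ t ⁻¹' B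
  have hKsub : ∀ n, K n ⊆ B := fun n x hx => by
    have h' : x ∈ φ 0 ⁻¹' B := (Set.mem_iInter₂.mp hx) 0 ⟨le_rfl, Nat.cast_nonneg n⟩
    rwa [Set.mem_preimage, h0] at h'
  have hKcl : ∀ n, IsClosed (K n) := fun n =>
    isClosed_biInter fun t ht => hBcl.preimage (hφ t ht.1)
  have hKcpt : ∀ n, IsCompact (K n) := fun n => hBc.of_isClosed_subset (hKcl n) (hKsub n)
  have hKne : ∀ n, (K n).Nonempty := fun n => by
    obtain ⟨x, hx⟩ := h n
    exact ⟨x, Set.mem_iInter₂.mpr hx⟩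
  have hmono : ∀ m n : ℕ, m ≤ n → K n ⊆ K m := fun m n hmn x hx =>
    Set.mem_iInter₂.mpr fun t ht =>
      (Set.mem_iInter₂.mp hx) t ⟨ht.1, ht.2.trans (by exact_mod_cast hmn)⟩
  have hdir : Directed (· ⊇ ·) K := fun m n =>
    ⟨max m n, hmono m _ (le_max_left m n), hmono n _ (le_max_right m n)⟩
  obtain ⟨x, hx⟩ :=
    IsCompact.nonempty_iInter_of_directed_nonempty_isCompact_isClosed K hdir hKne hKcpt hKcl
  refine ⟨x, fun t ht => ?_⟩
  obtain ⟨n, hn⟩ := exists_nat_ge t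
  exact (Set.mem_iInter₂.mp (Set.mem_iInter.mp hx n)) t ⟨ht, hn⟩

/-! ## The field ↔ coefficient dictionary on the phase space of order `N` -/

/-- **Energy on the phase space**: for a real divergence-free coefficient vector `c` on the
frequency ball of order `N`, `kineticEnergy (realTrigPoly (freqBall N) c̄) = ½ ∑ₖ ‖c k‖²`
(finite Parseval, `kineticEnergy_realTrigPoly`). [folklore] -/
theorem kineticEnergy_phase {N : ℕ} {c : ↥(freqBall (d := Fin 3) N) → EuclideanSpace ℂ (Fin 3)}
    (hc : c ∈ galerkinSubspace (freqBall N)) :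
    kineticEnergy (realTrigPoly (freqBall N) (coeffExt (freqBall N) c)) = 2⁻¹ * ∑ k, ‖c k‖ ^ 2 := by
  rw [kineticEnergy_realTrigPoly neg_mem_freqBall_of_mem
    (hc.1.isConjSymm_coeffExt neg_mem_freqBall_of_mem)]
  exact congrArg _ (sum_coeffExt (fun _ v => ‖v‖ ^ 2) c)

/-- **Work on the phase space**: for `f ∈ L²` and a real divergence-free coefficient vector `c`
on the frequency ball of order `N`, `∫ ⟪f, realTrigPoly (freqBall N) c̄⟫ = ∑ₖ Re ⟪f̂ k, c k⟫_ℂ`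
(Parseval against a band-limited field, `integral_inner_realTrigPoly_right`). [folklore] -/
theorem work_phase {N : ℕ} {f : UnitAddTorus (Fin 3) → EuclideanSpace ℝ (Fin 3)}
    (hf : MemLp f 2 volume) {c : ↥(freqBall (d := Fin 3) N) → EuclideanSpace ℂ (Fin 3)}
    (hc : c ∈ galerkinSubspace (freqBall N)) :
    ∫ x, ⟪f x, realTrigPoly (freqBall N) (coeffExt (freqBall N) c) x⟫_ℝ =
      ∑ k : ↥(freqBall (d := Fin 3) N),
        (inner ℂ (mFourierCoeff (EuclideanSpace.complexify ∘ f) k) (c k)).re := by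
  rw [integral_inner_realTrigPoly_right neg_mem_freqBall_of_mem
    (hc.1.isConjSymm_coeffExt neg_mem_freqBall_of_mem) hf]
  exact sum_coeffExt (fun k v => (inner ℂ (mFourierCoeff (EuclideanSpace.complexify ∘ f) k) v).re) c

/-! ## The stub -/

/-- **Finite-horizon principle for the Galerkin semiflow** (registered stub `stub_finiteHorizon`
of line `Sketch`). For `ν ≥ 0`, `f ∈ L²` and the block
`B = {a Galerkin mode of order N | kineticEnergy a ≤ E, (f, a) ≥ ε₀}`: if for every horizon `n`
some orbit of `Torus.galerkinFlow ν f N` stays in `B` on `[0, n]`, then some orbit stays in `B` for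
all `t ≥ 0`. Proof: in the finite-dimensional phase space `↥(galerkinSubspace (freqBall N))` the
coefficient block is closed and bounded (`kineticEnergy_phase`, `work_phase`), hence compact; apply
`finiteHorizon_of_compact` to the semiflow `galerkinPhaseFlow ν (f̂|_{≤N})`
(`galerkinPhaseFlow_semiflow`) and transport along the conjugacy `Torus.galerkinFlow_realTrigPoly` /
`IsGalerkinMode.galerkinFlow_eq`. [folklore] -/
theorem stub_finiteHorizon :
    ∀ (ν : ℝ) (N : ℕ) (f : UnitAddTorus (Fin 3) → EuclideanSpace ℝ (Fin 3)) (E ε₀ : ℝ), 0 ≤ ν →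
      MemLp f 2 volume →
      (∀ n : ℕ, ∃ a : UnitAddTorus (Fin 3) → EuclideanSpace ℝ (Fin 3), IsGalerkinMode N a ∧
        ∀ t ∈ Set.Icc (0 : ℝ) n,
          kineticEnergy (Torus.galerkinFlow ν f N t a) ≤ E ∧
            ε₀ ≤ ∫ x, ⟪f x, Torus.galerkinFlow ν f N t a x⟫_ℝ) →
      ∃ a : UnitAddTorus (Fin 3) → EuclideanSpace ℝ (Fin 3), IsGalerkinMode N a ∧ ∀ t : ℝ, 0 ≤ t →
        kineticEnergy (Torus.galerkinFlow ν f N t a) ≤ E ∧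
          ε₀ ≤ ∫ x, ⟪f x, Torus.galerkinFlow ν f N t a x⟫_ℝ := by
  intro ν N f E ε₀ hν hf hsoj
  -- the semiflow on the phase space `X` of order `N`, driven by `f̂|_{≤N}`
  have hS : ∀ k ∈ freqBall (d := Fin 3) N, -k ∈ freqBall (d := Fin 3) N := neg_mem_freqBall_of_mem
  have hg : IsRealCoeff (fourierRestrict (freqBall (d := Fin 3) N) f) :=
    isRealCoeff_mFourierCoeff (hf.integrable one_le_two)
  obtain ⟨hcont, h0, -⟩ := galerkinPhaseFlow_semiflow hν hS hg (ν := ν)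
  have hφ : ∀ t : ℝ, 0 ≤ t →
      Continuous (galerkinPhaseFlow ν (fourierRestrict (freqBall (d := Fin 3) N) f) t) :=
    fun t ht => (hcont.comp_continuous (Continuous.prodMk_right t)
      fun _ => ⟨Set.mem_Ici.2 ht, Set.mem_univ _⟩ :)
  -- energy and work as continuous functions of the coefficient vector
  let KEc : ↥(galerkinSubspace (freqBall (d := Fin 3) N)) → ℝ :=
    fun c => 2⁻¹ * ∑ k, ‖c.1 k‖ ^ 2
  let Wc : ↥(galerkinSubspace (freqBall (d := Fin 3) N)) → ℝ :=
    fun c => ∑ k : ↥(freqBall (d := Fin 3) N),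
      (inner ℂ (mFourierCoeff (EuclideanSpace.complexify ∘ f) k) (c.1 k)).re
  have hKEcont : Continuous KEc :=
    continuous_const.mul (continuous_finsetSum _ fun k _ =>
      (((continuous_apply k).comp continuous_subtype_val).norm).pow 2)
  have hWcont : Continuous Wc :=
    continuous_finsetSum _ fun k _ => Complex.continuous_re.comp
      (continuous_const.inner ((continuous_apply k).comp continuous_subtype_val))
  -- the coefficient block: closed and bounded, hence compact
  let Bc : Set ↥(galerkinSubspace (freqBall (d := Fin 3) N)) := {c | KEc c ≤ E} ∩ {c | ε₀ ≤ Wc c}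
  have hBcl : IsClosed Bc :=
    (isClosed_le hKEcont continuous_const).inter (isClosed_le continuous_const hWcont)
  have hBsub : Bc ⊆ Metric.closedBall 0 (Real.sqrt (2 * E)) := by
    intro c hc
    rw [Metric.mem_closedBall, dist_zero_right]
    change ‖c.1‖ ≤ Real.sqrt (2 * E)
    have h1 := norm_sq_le_sum_norm_sq c.1
    have h2 : 2⁻¹ * ∑ k, ‖c.1 k‖ ^ 2 ≤ E := hc.1
    rw [← abs_norm]
    exact Real.abs_le_sqrt (by linarith)
  have hBc : IsCompact Bc := (isCompact_closedBall _ _).of_isClosed_subset hBcl hBsub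
  -- Cantor intersection in the phase space
  obtain ⟨c, hc⟩ := finiteHorizon_of_compact hφ h0 hBc hBcl fun n => by
    obtain ⟨a, ha, hB⟩ := hsoj n
    refine ⟨⟨fourierRestrict (freqBall N) a, ha.fourierRestrict_mem⟩, fun t ht => ?_⟩
    obtain ⟨hE, hW⟩ := hB t ht
    have hmem := galerkinCoeffFlow_mem (ν := ν) (g := fourierRestrict (freqBall (d := Fin 3) N) f)
      ha.fourierRestrict_mem t
    rw [ha.galerkinFlow_eq t, kineticEnergy_phase hmem] at hE
    rw [ha.galerkinFlow_eq t, work_phase hf hmem] at hW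
    exact ⟨hE, hW⟩
  -- back to fields along the conjugacy
  refine ⟨realTrigPoly (freqBall N) (coeffExt (freqBall N) c.1),
    isGalerkinMode_realTrigPoly_coeffExt c.2, fun t ht => ?_⟩
  have hmem :=
    galerkinCoeffFlow_mem (ν := ν) (g := fourierRestrict (freqBall (d := Fin 3) N) f) c.2 t
  rw [Torus.galerkinFlow_realTrigPoly c.2 t, kineticEnergy_phase hmem, work_phase hf hmem]
  exact hc t ht

end Summit.AnomalousDissipation.AnomalousDissipation.Theorems.UniformWorkFloorTrap.Sketch

end
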